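import Literature.FieldTheory.Regular.FiniteAlgebraicClosure
import Mathlib.FieldTheory.IntermediateField.Adjoin.Algebra
import HarnessLib

/-!
# Finite generation of the relative algebraic closure: intermediate-field form

Corollary of `Literature.FieldTheory.Regular.exists_finset_isAlgClosedIn` (Lang, *Algebra*
VIII §4; the algebraic closure of `k` in a finitely generated extension is a finite extension of
`k`) for a finitely generated intermediate field `K` of an ambient extension `F/k`
(characteristic `0`): there is a finite set `s ⊆ K` of elements algebraic over `k` such that
`k(s)` is relatively algebraically closed in `K`
(`Literature.FieldTheory.Regular.exists_finset_isAlgClosedIn_of_fg`). This is the form used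
for the Γ-fields of Bays–Kirby (`Literature/NumberTheory/Transcendental`), which are
intermediate fields of one big field.

## References

* S. Lang, *Algebra*, 3rd ed., GTM 211, Springer 2002, VIII §4.
-/

noncomputable section

open Set

namespace Literature.FieldTheory.Regular

variable {k F : Type*} [Field k] [Field F] [Algebra k F]

/-- **The relative algebraic closure of `k` in a finitely generated `K ≤ F` is finitely
generated**: there is a finite `s ⊆ K` of elements algebraic over `k` with `k(s)` relatively
algebraically closed in `K`. [cite: Lang2002, VIII §4] -/
theorem exists_finset_isAlgClosedIn_of_fg [CharZero k] (K : IntermediateField k F) (hK : K.FG) :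
    ∃ s : Finset F, (↑s : Set F) ⊆ K ∧ (∀ x ∈ s, IsAlgebraic k x) ∧
      ∀ z ∈ K, IsAlgebraic (IntermediateField.adjoin k (↑s : Set F)) z →
        z ∈ IntermediateField.adjoin k (↑s : Set F) := by
  classical
  haveI : Algebra.EssFiniteType k K := IntermediateField.essFiniteType_iff.2 hK
  obtain ⟨s, hs, hclos⟩ := exists_finset_isAlgClosedIn (k := k) (E := K)
  have hlift : IntermediateField.lift (IntermediateField.adjoin k (↑s : Set K)) =
      IntermediateField.adjoin k (↑(s.image fun x : K => (x : F)) : Set F) := by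
    rw [IntermediateField.lift_adjoin, Finset.coe_image]
  refine ⟨s.image fun x : K => (x : F), ?_, ?_, ?_⟩
  · rw [Finset.coe_image]
    rintro _ ⟨x, -, rfl⟩
    exact x.2
  · intro x hx
    rw [Finset.mem_image] at hx
    obtain ⟨y, hy, rfl⟩ := hx
    have := (hs y hy).algebraMap (A := F)
    rwa [IntermediateField.algebraMap_apply] at this
  · intro z hz halg
    -- the isomorphism `k(s) ≅ k(s)` between the copy inside `K` and the copy inside `F`
    let f : IntermediateField.adjoin k (↑s : Set K) →+*
        IntermediateField.adjoin k (↑(s.image fun x : K => (x : F)) : Set F) :=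
      { toFun := fun r => ⟨((r : K) : F), by
          rw [← hlift, IntermediateField.mem_lift]; exact r.2⟩
        map_one' := Subtype.ext rfl
        map_mul' := fun _ _ => Subtype.ext rfl
        map_zero' := Subtype.ext rfl
        map_add' := fun _ _ => Subtype.ext rfl }
    have hfsurj : Function.Surjective f := by
      rintro ⟨y, hy⟩
      have hyK : y ∈ K := by
        rw [← hlift] at hy
        exact IntermediateField.lift_le _ hy
      have hyE : (⟨y, hyK⟩ : K) ∈ IntermediateField.adjoin k (↑s : Set K) := by
        rw [← IntermediateField.mem_lift, hlift]; exact hy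
      exact ⟨⟨⟨y, hyK⟩, hyE⟩, Subtype.ext rfl⟩
    have halg' : IsAlgebraic (IntermediateField.adjoin k (↑s : Set K)) (⟨z, hz⟩ : K) := by
      refine IsAlgebraic.of_ringHom_of_comp_eq f (algebraMap K F) ?_ hfsurj (algebraMap K F).injective ?_
      · rwa [IntermediateField.algebraMap_apply]
      · ext r
        rfl
    have hmem := hclos _ halg'
    have := (IntermediateField.mem_lift (⟨z, hz⟩ : K)).2 hmem
    rwa [hlift] at this

end Literature.FieldTheory.Regular
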